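import Literature.NumberTheory.EllipticCurves.PAdicOneVariableRelNormCoherentUnitsRayAction
import Literature.NumberTheory.GaloisRepresentations.LubinTateColemanUnitsImageGaloisTwo
import Literature.NumberTheory.GaloisRepresentations.LubinTateColemanCoordCoinvariantDivisionTwo
import HarnessLib

/-!
# The TWO-VARIABLE Coleman transform on coherent families of units is a monoid homomorphism intertwining `Γ_F` with the unit twists, so a
# levelwise relation II §2.4 (ii) among tower units, `(σ̃_𝔠·β_𝔞)·β_𝔠^{N𝔞} = (σ̃_𝔞·β_𝔠)·β_𝔞^{N𝔠}`, IS the module cocycle over `Λ = 𝒪_F⟦X⟧⟦T⟧`,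
# and de Shalit II §4.12 holds in the two-variable frame: **`∃! L ∈ 𝒪_F⟦X⟧⟦T⟧` with `φ_ε(Col β_𝔠) = (t_{χ(σ̃_𝔠)} − N𝔠)·L` for every `𝔠`**

De Shalit, *Iwasawa theory of elliptic curves with complex multiplication* (1987), I §3.8 (16)–(17); II §2.4 (ii), §4.12 (29)–(33); III §1.4 (5).
The one-level version is `PAdicOneVariableColemanCoordCocycleOfUnitsTwo` (`Col(β) = ofPS r_β ∈ 𝒪_E⟦Y⟧`).  THIS file does the same for the
two-variable transform `colemanImage` of `LubinTateColemanUnitsImageEquivTwo` (families `β = (β_m)_m` of norm-coherent units along the unramified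
tower `E_m`, baseNorm-coherent, with values in `(ColemanCoordModule hπ hq (intBase F) u hu γ)^{ℤ/d}` over `Λ = 𝒪_F⟦X⟧⟦T⟧`) — 0 sorry, no named facts:

* §1 pure algebra: `map_pow_eq_natCast_smul_of_map_mul` and ★ `twist_cocycle_of_map_mul_of_rel` — for ANY map `Col : B → M` from a monoid to a
  module with `Col(bb′) = Col b + Col b′`, `Col 1 = 0`, and operators with `Col(act_i b) = tw_i (Col b)`, a relation
  `act_c(β_a)·β_c^{n_a} = act_a(β_c)·β_a^{n_c}` gives `tw_c(Col β_a) + n_a • Col β_c = tw_a(Col β_c) + n_c • Col β_a`;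
* §2 `coherentFamilies hπ E hmono` — the baseNorm-coherent families as a SUBMONOID of `∏_m 𝒰(E_m·K_π^∞)` (termwise monoid structure
  `RelNormCoherentUnits.instCommMonoid`, section-local); `galActCoherent σ̃` (the action of `Γ_F`, `galAct_baseNormCoherent`);
  `colemanImageCoh β := colemanImage … β.2` and its laws ★ `colemanImageCoh_mul/_one/_pow/_galAct` (`Col(σ̃β) = σ_{χ(σ̃)} ∘ Col β` for `σ̃`
  fixing `E_∞`, from `colemanImage_galAct_of_forall_smul_eq`);
* §3 ★★ `colemanImageCoh_cocycle` — the LEVELWISE unit relation (at each `m`, verbatim the shape of the measure lane's `hrel_ellipticUnitsLocal`)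
  gives, for every component `j : ℤ/d`, the cocycle `σ_{χ(σ̃_c)}(x a) + C n_a • x c = σ_{χ(σ̃_a)}(x c) + C n_c • x a` for `x c := Col(β c) j`;
  ★★★ `existsUnique_colemanDeltaCoinvFun_colemanImageCoh_eq_mul` — with `χ(σ̃_{a₁}) = γ`, `π ∣ n_{a₁} − 1` and `χ(σ̃_{a₂}) = γ^m`, `n_{a₁}^m ≠ n_{a₂}`:
  **`∃! L ∈ 𝒪_F⟦X⟧⟦T⟧` with `φ_ε(Col(β c) j) = (t_{χ(σ̃_c)} − C n_c)·L` for all `c`** (`LubinTateColemanCoordCoinvariantDivisionTwo` over the base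
  `S = 𝒪_F⟦X⟧`, `hreg = eq_zero_of_C_pi_mul_eq_zero_integer`); `natCast_sub_one_mem_span_intBase` (the oddness condition in `Λ`-currency).

`L` is de Shalit's two-variable `μ(𝔣)` (`ε`-part, one prime above `𝔭`, `q = 2`) as a power series; with `β_𝔞 = (e(𝔞)_{𝔓,m})_m` it feeds
`colemanDeltaCoinvFun_map_span_range_eq_span_mul_of_forall` (`φ_ε(Λ·Col 𝒞) = L·J_ε`) and the `char`-identities of
`Summit…PrintCf2RubinValueTwoColemanCoinvariantChar{,OfClosure,Series}`.  Cell `bsd-print-cf2`, width seat `bsd-line-cf2c-w7` g13.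

## References
* E. de Shalit, *Iwasawa theory of elliptic curves with complex multiplication* (1987), Ch. I §3.4 Lemma, §3.8 (16)–(17); Ch. II §2.4 (ii), §4.5,
  §4.12 (29)–(33); Ch. III §1.4 (5). [deShalit1987]
-/

noncomputable section

namespace Literature.NumberTheory.EllipticCurves

/-! ### §1. Pure algebra: a logarithm-like map turns the multiplicative relation into the module cocycle -/

section Algebra

/-- `Col(b^n) = n • Col b` for a map with `Col(bb′) = Col b + Col b′`, `Col 1 = 0`. [cite: deShalit1987, Ch. I §3.4 Lemma (i)] -/
theorem map_pow_eq_natCast_smul_of_map_mul {R M B : Type*} [Semiring R] [AddCommMonoid M] [Module R M] [Monoid B] (Col : B → M)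
    (hmul : ∀ b b' : B, Col (b * b') = Col b + Col b') (hone : Col 1 = 0) (b : B) (n : ℕ) :
    Col (b ^ n) = (n : R) • Col b := by
  induction n with
  | zero => rw [pow_zero, hone, Nat.cast_zero, zero_smul]
  | succ n ih => rw [pow_succ, hmul, ih, Nat.cast_succ, add_smul, one_smul]

/-- ★ **The multiplicative relation `act_c(β_a)·β_c^{n_a} = act_a(β_c)·β_a^{n_c}` becomes the cocycle
`tw_c(Col β_a) + n_a • Col β_c = tw_a(Col β_c) + n_c • Col β_a`** under any `Col` with `Col(bb′) = Col b + Col b′` and `Col ∘ act_i = tw_i ∘ Col`.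
[cite: deShalit1987, Ch. II §2.4 (ii), §4.12 (29)] -/
theorem twist_cocycle_of_map_mul_of_rel {R M B I : Type*} [Semiring R] [AddCommMonoid M] [Module R M] [Monoid B] (Col : B → M)
    (hmul : ∀ b b' : B, Col (b * b') = Col b + Col b') (hone : Col 1 = 0) (act : I → B → B) (tw : I → M → M)
    (hact : ∀ (i : I) (b : B), Col (act i b) = tw i (Col b)) (β : I → B) (n : I → ℕ)
    (hrel : ∀ a c : I, act c (β a) * β c ^ n a = act a (β c) * β a ^ n c) (a c : I) :
    tw c (Col (β a)) + (n a : R) • Col (β c) = tw a (Col (β c)) + (n c : R) • Col (β a) := by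
  have h := congrArg Col (hrel a c)
  rwa [hmul, hmul, hact, hact, map_pow_eq_natCast_smul_of_map_mul (R := R) Col hmul hone,
    map_pow_eq_natCast_smul_of_map_mul (R := R) Col hmul hone] at h

end Algebra

/-! ### §2. Coherent families form a monoid; the two-variable transform is a homomorphism intertwining `Γ_F` -/

section TwoVariable

open ValuativeRel IsLocalRing Field
open Literature.NumberTheory.GaloisRepresentations Literature.NumberTheory.GaloisRepresentations.IsNonarchimedeanLocalField
  Literature.NumberTheory.GaloisRepresentations.LubinTate

variable {F : Type} [Field F] [ValuativeRel F] [TopologicalSpace F] [IsNonarchimedeanLocalField F]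

attribute [local instance] ltNormUniformSpace ltNormIsUniformAddGroup rk1 nF nE fintypeResidueField
attribute [local instance] RelNormCoherentUnits.instCommMonoid

variable {p : ℕ} [hp : Fact p.Prime] {d : ℕ} (hd : d.Coprime p)
variable {π : 𝒪[F]} (hπ : (valuation F).IsUniformizer (π : F))
variable (E : ℕ → IntermediateField F (AlgebraicClosure F)) [∀ m, FiniteDimensional F (E m)] [∀ m, Normal F (E m)]
  [∀ m, IsGalois F (E m)] (hmono : Monotone E) (hE : ∀ m, E m ≤ maxUnramified F) (hdeg : ∀ m, Module.finrank F (E m) = d * p ^ m)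
  {σ₀ : absoluteGaloisGroup F} (hσ₀ : IsAbsArithFrob σ₀) (hq : residueFieldCard F = 2)
variable (u : (LTCoeff F)ˣ) (hu : LTCoeff.of F π = residueFieldCard F * u) (γ : 𝒪[F]ˣ)

omit [∀ m, Normal F (E m)] in
/-- **The baseNorm-coherent families `(β_m)_m`, `N_{E_{m+1}/E_m} β_{m+1} = β_m`, as a submonoid of `∏_m 𝒰(E_m·K_π^∞)`** (termwise products).
[cite: deShalit1987, Ch. I §3.8 (16); Ch. III §1.3] -/
def coherentFamilies : Submonoid (∀ m, RelNormCoherentUnits hπ (E m)) where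
  carrier := {β | ∀ m, (β (m + 1)).baseNorm hπ (hmono (Nat.le_succ m)) = β m}
  mul_mem' {_ _} hβ hβ' := fun m => baseNormCoherent_mul hπ E hmono hβ hβ' m
  one_mem' := fun m => baseNormCoherent_one hπ E hmono m

omit [∀ m, Normal F (E m)] in
/-- Membership (unfolding). [cite: deShalit1987, Ch. I §3.8 (16)] -/
theorem mem_coherentFamilies_iff (β : ∀ m, RelNormCoherentUnits hπ (E m)) :
    β ∈ coherentFamilies hπ E hmono ↔ ∀ m, (β (m + 1)).baseNorm hπ (hmono (Nat.le_succ m)) = β m := Iff.rfl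

/-- **The action of `σ̃ ∈ Γ_F` on coherent families** (termwise `galAct`; coherence by `galAct_baseNormCoherent`). [cite: deShalit1987, Ch. I §3.8 (16)] -/
def galActCoherent (σ : absoluteGaloisGroup F) (β : coherentFamilies hπ E hmono) : coherentFamilies hπ E hmono :=
  ⟨fun m => (β.1 m).galAct σ, fun m => galAct_baseNormCoherent hπ E hmono σ β.2 m⟩

/-- Components of `σ̃·β` (unfolding). [cite: deShalit1987, Ch. I §2.3 (iv)] -/
@[simp] theorem coe_galActCoherent (σ : absoluteGaloisGroup F) (β : coherentFamilies hπ E hmono) (m : ℕ) :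
    (galActCoherent hπ E hmono σ β : ∀ m, RelNormCoherentUnits hπ (E m)) m = (β.1 m).galAct σ := rfl

variable [NeZero d] [IsAdicComplete (Ideal.span {(p : 𝒪[F])}) 𝒪[F]]
variable {θ : ∀ m, unitBall (E m)} (hθ : ∀ m, IsIntegralNormalGen (E m) (θ m))
  (hcoh : ∀ m, unitBallTrace (hmono (Nat.le_succ m)) (θ (m + 1)) = θ m)

/-- **`Col(β)`** for a coherent family `β`: the two-variable Coleman transform `colemanImage` read on the submonoid.
[cite: deShalit1987, Ch. I §3.8 (17); Ch. III §1.3] -/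
def colemanImageCoh (β : coherentFamilies hπ E hmono) : ZMod d → ColemanCoordModule hπ hq (intBase F) u hu γ :=
  colemanImage hd hπ E hmono hE hdeg hσ₀ hq u hu γ hθ hcoh β.2

/-- Unfolding. [cite: deShalit1987, Ch. I §3.8 (17)] -/
theorem colemanImageCoh_def (β : coherentFamilies hπ E hmono) :
    colemanImageCoh hd hπ E hmono hE hdeg hσ₀ hq u hu γ hθ hcoh β = colemanImage hd hπ E hmono hE hdeg hσ₀ hq u hu γ hθ hcoh β.2 := rfl

include hdeg in
/-- ★ **`Col(ββ′) = Col β + Col β′`** on coherent families. [cite: deShalit1987, Ch. I §3.4 Lemma (i), §3.8 (17)] -/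
theorem colemanImageCoh_mul (β β' : coherentFamilies hπ E hmono) :
    colemanImageCoh hd hπ E hmono hE hdeg hσ₀ hq u hu γ hθ hcoh (β * β') =
      colemanImageCoh hd hπ E hmono hE hdeg hσ₀ hq u hu γ hθ hcoh β + colemanImageCoh hd hπ E hmono hE hdeg hσ₀ hq u hu γ hθ hcoh β' := by
  rw [colemanImageCoh_def, colemanImageCoh_def, colemanImageCoh_def,
    ← colemanImage_mul hd hπ E hmono hE hdeg hσ₀ hq u hu γ hθ hcoh β.2 β'.2 (baseNormCoherent_mul hπ E hmono β.2 β'.2)]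

include hdeg in
/-- **`Col(1) = 0`.** [cite: deShalit1987, Ch. I §3.4 Lemma (i)] -/
theorem colemanImageCoh_one :
    colemanImageCoh hd hπ E hmono hE hdeg hσ₀ hq u hu γ hθ hcoh 1 = 0 := by
  rw [colemanImageCoh_def, ← colemanImage_one hd hπ E hmono hE hdeg hσ₀ hq u hu γ hθ hcoh]

variable [IsAdicComplete (Ideal.span {intBase F (LTCoeff.of F π)}) (PowerSeries 𝒪[F])]

include hdeg in
/-- **`Col(β^n) = n • Col β`.** [cite: deShalit1987, Ch. I §3.4 Lemma (i), §3.8 (17)] -/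
theorem colemanImageCoh_pow (β : coherentFamilies hπ E hmono) (n : ℕ) :
    colemanImageCoh hd hπ E hmono hE hdeg hσ₀ hq u hu γ hθ hcoh (β ^ n) =
      (n : PowerSeries (PowerSeries 𝒪[F])) • colemanImageCoh hd hπ E hmono hE hdeg hσ₀ hq u hu γ hθ hcoh β :=
  map_pow_eq_natCast_smul_of_map_mul _ (colemanImageCoh_mul hd hπ E hmono hE hdeg hσ₀ hq u hu γ hθ hcoh)
    (colemanImageCoh_one hd hπ E hmono hE hdeg hσ₀ hq u hu γ hθ hcoh) β n

include hmono hE hdeg hσ₀ in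
/-- ★ **`Col(σ̃·β) = σ_{χ_π(σ̃)} ∘ Col β`** for `σ̃ ∈ Γ_F` fixing every `E_m` (`colemanImage_galAct_of_forall_smul_eq`).
[cite: deShalit1987, Ch. I §3.4 Lemma (ii), §3.8 (17)] -/
theorem colemanImageCoh_galAct (β : coherentFamilies hπ E hmono) {σ : absoluteGaloisGroup F}
    (hσE : ∀ m (x : E m), σ • (x : AlgebraicClosure F) = x) :
    colemanImageCoh hd hπ E hmono hE hdeg hσ₀ hq u hu γ hθ hcoh (galActCoherent hπ E hmono σ β) =
      (unitTwistₗ hπ hq (intBase F) u hu γ (lubinTateChar hπ σ)).compLeft (ZMod d)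
        (colemanImageCoh hd hπ E hmono hE hdeg hσ₀ hq u hu γ hθ hcoh β) := by
  rw [colemanImageCoh_def, colemanImageCoh_def, ← colemanImage_galAct_of_forall_smul_eq hd hπ E hmono hE hdeg hσ₀ hq u hu γ hθ hcoh β.2 hσE]
  rfl

/-! ### §3. The levelwise unit relation gives the cocycle and de Shalit II §4.12 in the two-variable frame -/

include hdeg in
/-- ★★ **The LEVELWISE relation among tower units IS the module cocycle over `Λ = 𝒪_F⟦X⟧⟦T⟧`**: if at every level `m`
`(σ̃_c·β_{a,m})·β_{c,m}^{n_a} = (σ̃_a·β_{c,m})·β_{a,m}^{n_c}` (the `σ̃_i ∈ Γ_F` fixing `E_∞`), then for every component `j : ℤ/d` the family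
`x c := Col(β c) j` satisfies `σ_{χ(σ̃_c)}(x a) + C n_a • x c = σ_{χ(σ̃_a)}(x c) + C n_c • x a`. [cite: deShalit1987, Ch. II §2.4 (ii), §4.12 (29); Ch. I §3.8 (17)] -/
theorem colemanImageCoh_cocycle {I : Type*} (β : I → coherentFamilies hπ E hmono) (σ : I → absoluteGaloisGroup F)
    (hσE : ∀ (i : I) (m : ℕ) (x : E m), σ i • (x : AlgebraicClosure F) = x) (n : I → ℕ)
    (hrel : ∀ (a c : I) (m : ℕ), ((β a).1 m).galAct (σ c) * (β c).1 m ^ n a = ((β c).1 m).galAct (σ a) * (β a).1 m ^ n c)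
    (a c : I) (j : ZMod d) :
    unitTwistₗ hπ hq (intBase F) u hu γ (lubinTateChar hπ (σ c)) (colemanImageCoh hd hπ E hmono hE hdeg hσ₀ hq u hu γ hθ hcoh (β a) j) +
        (PowerSeries.C ((n a : ℕ) : PowerSeries 𝒪[F]) : PowerSeries (PowerSeries 𝒪[F])) •
          colemanImageCoh hd hπ E hmono hE hdeg hσ₀ hq u hu γ hθ hcoh (β c) j =
      unitTwistₗ hπ hq (intBase F) u hu γ (lubinTateChar hπ (σ a)) (colemanImageCoh hd hπ E hmono hE hdeg hσ₀ hq u hu γ hθ hcoh (β c) j) +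
        (PowerSeries.C ((n c : ℕ) : PowerSeries 𝒪[F]) : PowerSeries (PowerSeries 𝒪[F])) •
          colemanImageCoh hd hπ E hmono hE hdeg hσ₀ hq u hu γ hθ hcoh (β a) j := by
  -- the relation in the submonoid
  have hrel' : ∀ a c : I, galActCoherent hπ E hmono (σ c) (β a) * β c ^ n a = galActCoherent hπ E hmono (σ a) (β c) * β a ^ n c :=
    fun a c => Subtype.ext (funext fun m => by
      simp only [Submonoid.coe_mul, SubmonoidClass.coe_pow, Pi.mul_apply, Pi.pow_apply, coe_galActCoherent]
      exact hrel a c m)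
  have h := twist_cocycle_of_map_mul_of_rel (R := PowerSeries (PowerSeries 𝒪[F]))
    (colemanImageCoh hd hπ E hmono hE hdeg hσ₀ hq u hu γ hθ hcoh) (colemanImageCoh_mul hd hπ E hmono hE hdeg hσ₀ hq u hu γ hθ hcoh)
    (colemanImageCoh_one hd hπ E hmono hE hdeg hσ₀ hq u hu γ hθ hcoh) (fun i => galActCoherent hπ E hmono (σ i))
    (fun i G => (unitTwistₗ hπ hq (intBase F) u hu γ (lubinTateChar hπ (σ i))).compLeft (ZMod d) G)
    (fun i b => colemanImageCoh_galAct hd hπ E hmono hE hdeg hσ₀ hq u hu γ hθ hcoh b (hσE i)) β n hrel' a c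
  have hj := congrFun h j
  rw [Pi.add_apply, Pi.add_apply, Pi.smul_apply, Pi.smul_apply, LinearMap.compLeft_apply, LinearMap.compLeft_apply,
    Function.comp_apply, Function.comp_apply] at hj
  rwa [map_natCast, map_natCast]

omit [IsAdicComplete (Ideal.span {intBase F (LTCoeff.of F π)}) (PowerSeries 𝒪[F])] in
omit hp [NeZero d] [IsAdicComplete (Ideal.span {(p : 𝒪[F])}) 𝒪[F]] in
/-- The oddness condition in `Λ`-currency: `π ∣ n − 1` in `𝒪_F` gives `C n − 1 ∈ (ι_ℤ π)` in `𝒪_F⟦X⟧`. [cite: deShalit1987, Ch. II §4.12 (32)] -/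
theorem natCast_sub_one_mem_span_intBase {n : ℕ} (h : (π : 𝒪[F]) ∣ (n : 𝒪[F]) - 1) :
    ((n : ℕ) : PowerSeries 𝒪[F]) - 1 ∈ Ideal.span {intBase F (LTCoeff.of F π)} := by
  rw [intBase_of, Ideal.mem_span_singleton]
  have e : ((n : ℕ) : PowerSeries 𝒪[F]) - 1 = PowerSeries.C ((n : 𝒪[F]) - 1) := by
    rw [map_sub, map_natCast, map_one]
  rw [e]
  exact map_dvd PowerSeries.C h

variable (w : 𝒪[F]ˣ) (hγ : (γ : 𝒪[F]) = 1 + π ^ 2 * w) (ε : PowerSeries (PowerSeries 𝒪[F])) (hε : ε * ε = 1)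

include hdeg hε in
/-- ★★★ **DE SHALIT II §4.12 IN THE TWO-VARIABLE FRAME** (`ε`-part, one prime, `q = 2`): let the coherent tower families `β_c` satisfy the levelwise
relation of `colemanImageCoh_cocycle`, let `a₁` have `χ_π(σ̃_{a₁}) = γ` and `π ∣ n_{a₁} − 1`, and let `a₂` make `(t_{χ(σ̃_{a₂})} − C n_{a₂})(n_{a₁} − 1)`
non-zero in `𝒪_F⟦X⟧`.  Then for every component `j : ℤ/d` **there is a UNIQUE `L ∈ Λ = 𝒪_F⟦X⟧⟦T⟧` with `φ_ε(Col(β c) j) = (t_{χ(σ̃_c)} − C n_c)·L`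
for every `c`** — de Shalit's two-variable measure `μ(𝔣)` (`ε`-part) as a power series. [cite: deShalit1987, Ch. II §4.12 (29)–(33); Ch. III §1.4 (5)] -/
theorem existsUnique_colemanDeltaCoinvFun_colemanImageCoh_eq_mul {I : Type*} (β : I → coherentFamilies hπ E hmono)
    (σ : I → absoluteGaloisGroup F) (hσE : ∀ (i : I) (m : ℕ) (x : E m), σ i • (x : AlgebraicClosure F) = x) (n : I → ℕ)
    (hrel : ∀ (a c : I) (m : ℕ), ((β a).1 m).galAct (σ c) * (β c).1 m ^ n a = ((β c).1 m).galAct (σ a) * (β a).1 m ^ n c)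
    (a₁ a₂ : I) (hv₁ : lubinTateChar hπ (σ a₁) = γ) (hn₁ : (π : 𝒪[F]) ∣ (n a₁ : 𝒪[F]) - 1)
    (ha₂ : tEval (natCast_sub_one_mem_span_intBase (F := F) hn₁)
      (colemanDeltaCoinvFun hπ hq (intBase F) u hu γ (eq_zero_of_C_pi_mul_eq_zero_integer hπ) w hγ ε
          (unitTwistₗ hπ hq (intBase F) u hu γ (lubinTateChar hπ (σ a₂)) (TActModule.ofPS _ _ 1)) -
        PowerSeries.C ((n a₂ : ℕ) : PowerSeries 𝒪[F])) ≠ 0) (j : ZMod d) :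
    ∃! L : PowerSeries (PowerSeries 𝒪[F]), ∀ c : I,
      colemanDeltaCoinvFun hπ hq (intBase F) u hu γ (eq_zero_of_C_pi_mul_eq_zero_integer hπ) w hγ ε
          (colemanImageCoh hd hπ E hmono hE hdeg hσ₀ hq u hu γ hθ hcoh (β c) j) =
        (colemanDeltaCoinvFun hπ hq (intBase F) u hu γ (eq_zero_of_C_pi_mul_eq_zero_integer hπ) w hγ ε
            (unitTwistₗ hπ hq (intBase F) u hu γ (lubinTateChar hπ (σ c)) (TActModule.ofPS _ _ 1)) -
          PowerSeries.C ((n c : ℕ) : PowerSeries 𝒪[F])) * L :=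
  existsUnique_colemanDeltaCoinvFun_eq_mul_of_ne_zero hπ hq (intBase F) u hu γ (eq_zero_of_C_pi_mul_eq_zero_integer hπ) w hγ ε hε
    (fun c => colemanImageCoh hd hπ E hmono hE hdeg hσ₀ hq u hu γ hθ hcoh (β c) j) (fun c => lubinTateChar hπ (σ c))
    (fun c => PowerSeries.C ((n c : ℕ) : PowerSeries 𝒪[F]))
    (fun a c => colemanImageCoh_cocycle hd hπ E hmono hE hdeg hσ₀ hq u hu γ hθ hcoh β σ hσE n hrel a c j) a₁ a₂ hv₁ rfl
    (natCast_sub_one_mem_span_intBase (F := F) hn₁) ha₂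

include hdeg hε in
/-- **Concrete auxiliary condition**: `χ_π(σ̃_{a₂}) = γ^m` and `n_{a₁}^m ≠ n_{a₂}` (as natural numbers; `F` of characteristic zero).
[cite: deShalit1987, Ch. II §4.12 (29)–(33)] -/
theorem existsUnique_colemanDeltaCoinvFun_colemanImageCoh_eq_mul_of_pow [CharZero F] {I : Type*} (β : I → coherentFamilies hπ E hmono)
    (σ : I → absoluteGaloisGroup F) (hσE : ∀ (i : I) (m : ℕ) (x : E m), σ i • (x : AlgebraicClosure F) = x) (n : I → ℕ)
    (hrel : ∀ (a c : I) (m : ℕ), ((β a).1 m).galAct (σ c) * (β c).1 m ^ n a = ((β c).1 m).galAct (σ a) * (β a).1 m ^ n c)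
    (a₁ a₂ : I) (hv₁ : lubinTateChar hπ (σ a₁) = γ) (hn₁ : (π : 𝒪[F]) ∣ (n a₁ : 𝒪[F]) - 1)
    {m : ℕ} (hv₂ : lubinTateChar hπ (σ a₂) = γ ^ m) (hne : n a₁ ^ m ≠ n a₂) (j : ZMod d) :
    ∃! L : PowerSeries (PowerSeries 𝒪[F]), ∀ c : I,
      colemanDeltaCoinvFun hπ hq (intBase F) u hu γ (eq_zero_of_C_pi_mul_eq_zero_integer hπ) w hγ ε
          (colemanImageCoh hd hπ E hmono hE hdeg hσ₀ hq u hu γ hθ hcoh (β c) j) =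
        (colemanDeltaCoinvFun hπ hq (intBase F) u hu γ (eq_zero_of_C_pi_mul_eq_zero_integer hπ) w hγ ε
            (unitTwistₗ hπ hq (intBase F) u hu γ (lubinTateChar hπ (σ c)) (TActModule.ofPS _ _ 1)) -
          PowerSeries.C ((n c : ℕ) : PowerSeries 𝒪[F])) * L := by
  refine existsUnique_colemanDeltaCoinvFun_colemanImageCoh_eq_mul hd hπ E hmono hE hdeg hσ₀ hq u hu γ hθ hcoh w hγ ε hε β σ hσE n hrel
    a₁ a₂ hv₁ hn₁ ?_ j
  rw [hv₂, tEval_colemanDeltaCoinvFun_unitTwistₗ_pow_one_sub_C_sub_one, sub_ne_zero]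
  intro h
  apply hne
  have h' := congrArg (fun s : PowerSeries 𝒪[F] => ((PowerSeries.constantCoeff s : 𝒪[F]) : F)) h
  simp only [map_pow, map_natCast] at h'
  push_cast at h'
  exact_mod_cast h'

end TwoVariable

end Literature.NumberTheory.EllipticCurves
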